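import Mathlib
import Summits.ValiantsHypothesis.ValiantsHypothesis.Theorems.FifoMatchingNNLinearDegreeCofactorHardInflateBand
import HarnessLib

/-!
# Route FifoMatching — crux `NNLinearDegreeCofactorHard` (stmt-ValiantsHypothesis-23918), line `internal_cofactor`:
# stub S2b, unit (E″) — COUNTING the bit strings that violate the band (SPEC S7)

For the inflated queue word `W = InflateWord.inflateWord R L m y` (unit (A″)), height
`h(t) = #openers<t − #closers<t`, envelope `L + need t`, head end `A = vpos (2·jA)` and tail start `E′`, this file
proves the S7 estimate: the number of bit strings `y` for which SOME `t ∈ [A, E′]` has `|h(t) − L − need t| > B` is at most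
`2J·exp(−m₀²/(8J))·4^J` (`J = #Rᶜ/2`) as soon as `B ≥ m₀ + 2 + |c₀|`, where `c₀ = 2·jA − #(R ∩ [0,A)) − L − need A` is the
(deterministic) head overshoot.  Chain: `…InflateBand` (deviation telescoping, V-rank reindexing, pair grouping, pair
step = centred step) + `…PairWalkBand.card_filter_pairWalk_exits_le_of_mask` (Hoeffding in counting form).

* `prefixSum_eq_card_sub_card` — the `±1` prefix sum of a word is `#openers<t − #closers<t`;
* `maskedSum_eq` — the masked `Fin J`-indexed pair walk of `…PairWalkBand` equals `∑_{jA ≤ j < k} (g (2j) + g (2j+1))`;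
* `card_filter_band_violated_le` — **the S7 count**.

Honest framing: bookkeeping for one unit of one stub of an OPEN crux; nothing here bears on the crux, `NNDivisionHard`,
`NNNotVP` or `VP ≠ VNP` (NOT proved).  No definitions, no named facts. [folklore]
-/

noncomputable section

-- Sub = Summit single-conjunct layout: the duplicated namespace component is mandated by the tree.
set_option linter.dupNamespace false

namespace Summit.ValiantsHypothesis.ValiantsHypothesis.Theorems.FifoMatching.NNLinearDegreeCofactorHard.InflateBand

open Finset Real Literature.Computability.AlgebraicComplexity
open Summit.ValiantsHypothesis.ValiantsHypothesis.Theorems.FifoMatching.NNLinearDegreeCofactorHard.InflateWord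
open Summit.ValiantsHypothesis.ValiantsHypothesis.Theorems.FifoMatching.NNLinearDegreeCofactorHard.InternalCofactor

variable {N : ℕ} (R : Finset (Fin N)) (L m : ℕ) (y : Fin (2 * (Rᶜ.card / 2)) → Bool)

/-! ### Prefix sums versus opener/closer counts -/
/-- The `±1` prefix sum of a word is `#openers<t − #closers<t`. [folklore] -/
theorem prefixSum_eq_card_sub_card (W : Fin N → Bool) (t : ℕ) :
    (∑ s : Fin N, (if (s : ℕ) < t then (if W s then (1 : ℤ) else -1) else 0)) =
      (((openerSet W).filter fun i : Fin N => i.val < t).card : ℤ) -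
        (((closerSet W).filter fun i : Fin N => i.val < t).card : ℤ) := by
  classical
  have h1 : ((openerSet W).filter fun i : Fin N => i.val < t) = univ.filter fun s : Fin N => (s : ℕ) < t ∧ W s = true := by
    ext s; simp only [openerSet, mem_filter, mem_univ, true_and]; tauto
  have h2 : ((closerSet W).filter fun i : Fin N => i.val < t) = univ.filter fun s : Fin N => (s : ℕ) < t ∧ W s = false := by
    ext s; simp only [closerSet, mem_filter, mem_univ, true_and]; tauto
  rw [h1, h2, card_filter, card_filter, Nat.cast_sum, Nat.cast_sum, ← sum_sub_distrib]
  refine sum_congr rfl fun s _ => ?_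
  by_cases hs : (s : ℕ) < t <;> cases W s <;> simp [hs]

/-! ### The masked pair walk, read in `ℕ`-indices -/
/-- The masked `Fin J`-indexed centred pair walk of `…PairWalkBand` (mask = the middle pairs, `τ = isInflate`) up to
`k ≤ jE` equals the `ℕ`-indexed sum of the pair increments `g (2j) + g (2j+1)` over `jA ≤ j < k`. [folklore] -/
theorem maskedSum_eq {k : ℕ} (hk : k ≤ tailPairs R L m) :
    (∑ j : Fin (Rᶜ.card / 2), (if (j : ℕ) < k then
        (if headPairs R L m ≤ (j : ℕ) ∧ (j : ℕ) < tailPairs R L m then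
          (if isInflate R L m j then
            (if y ⟨2 * j.val, by have := j.isLt; omega⟩ = y ⟨2 * j.val + 1, by have := j.isLt; omega⟩
              then (1 : ℝ) else -1)
           else ((if y ⟨2 * j.val, by have := j.isLt; omega⟩ then (1 : ℝ) else -1) +
             (if y ⟨2 * j.val + 1, by have := j.isLt; omega⟩ then (1 : ℝ) else -1)))
         else 0)
        else 0)) =
      ((∑ j ∈ Ico (headPairs R L m) k,
        (((if preLetter R L m y (2 * j) then (1 : ℤ) else -1) -
            (if (2 * j) % 2 = 0 ∧ isInflate R L m ((2 * j) / 2) = true then 1 else 0)) +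
          ((if preLetter R L m y (2 * j + 1) then (1 : ℤ) else -1) -
            (if (2 * j + 1) % 2 = 0 ∧ isInflate R L m ((2 * j + 1) / 2) = true then 1 else 0))) : ℤ) : ℝ) := by
  have hJ : tailPairs R L m ≤ Rᶜ.card / 2 := by
    have := two_mul_tailPairs_le R L m; omega
  set G : ℕ → ℤ := fun j =>
    ((if preLetter R L m y (2 * j) then (1 : ℤ) else -1) -
        (if (2 * j) % 2 = 0 ∧ isInflate R L m ((2 * j) / 2) = true then 1 else 0)) +
      ((if preLetter R L m y (2 * j + 1) then (1 : ℤ) else -1) -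
        (if (2 * j + 1) % 2 = 0 ∧ isInflate R L m ((2 * j + 1) / 2) = true then 1 else 0)) with hG
  set F : ℕ → ℝ := fun j => if j < k then (if headPairs R L m ≤ j ∧ j < tailPairs R L m then ((G j : ℤ) : ℝ)
    else 0) else 0 with hF
  -- (a) the `Fin`-indexed terms are `F j.val`
  have ha : ∀ j : Fin (Rᶜ.card / 2),
      (if (j : ℕ) < k then
        (if headPairs R L m ≤ (j : ℕ) ∧ (j : ℕ) < tailPairs R L m then
          (if isInflate R L m j then
            (if y ⟨2 * j.val, by have := j.isLt; omega⟩ = y ⟨2 * j.val + 1, by have := j.isLt; omega⟩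
              then (1 : ℝ) else -1)
           else ((if y ⟨2 * j.val, by have := j.isLt; omega⟩ then (1 : ℝ) else -1) +
             (if y ⟨2 * j.val + 1, by have := j.isLt; omega⟩ then (1 : ℝ) else -1)))
         else 0)
        else 0) = F j.val := by
    intro j
    simp only [hF]
    by_cases h1 : (j : ℕ) < k
    · rw [if_pos h1, if_pos h1]
      by_cases h2 : headPairs R L m ≤ (j : ℕ) ∧ (j : ℕ) < tailPairs R L m
      · rw [if_pos h2, if_pos h2, hG]
        exact (delta_pair_eq R L m y j.val h2.1 j.isLt).symm
      · rw [if_neg h2, if_neg h2]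
    · rw [if_neg h1, if_neg h1]
  rw [sum_congr rfl fun j _ => ha j, Fin.sum_univ_eq_sum_range (f := F)]
  -- (c) restrict to `Ico jA k`
  have hsub : Ico (headPairs R L m) k ⊆ range (Rᶜ.card / 2) := fun j hj => by
    rw [mem_Ico] at hj; rw [mem_range]; omega
  rw [← sum_subset hsub (fun j hj hj' => ?_)]
  · push_cast
    refine sum_congr rfl fun j hj => ?_
    rw [mem_Ico] at hj
    simp only [hF, hG]
    rw [if_pos hj.2, if_pos ⟨hj.1, by omega⟩]
  · simp only [hF]
    rw [mem_Ico, not_and_or, not_le] at hj'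
    by_cases h1 : j < k
    · have h2 : ¬ (headPairs R L m ≤ j ∧ j < tailPairs R L m) := fun h => by omega
      rw [if_pos h1, if_neg h2]
    · rw [if_neg h1]

/-! ### The final arithmetic -/
/-- Triangle inequality bookkeeping: `h − nt = (c − na) + (S + θ)`, `|θ| ≤ 2`, `m₀ + 2 + |c − L − na| ≤ B < |h − L − nt|`
give `m₀ ≤ |S|`. [folklore] -/
theorem abs_walk_ge {h nt L' c na S θ B m₀ : ℝ} (hdev : h - nt = (c - na) + (S + θ)) (hθ : |θ| ≤ 2)
    (hB : m₀ + 2 + |c - L' - na| ≤ B) (hbig : B < |h - L' - nt|) : m₀ ≤ |S| := by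
  have e : h - L' - nt = S + (c - L' - na) + θ := by linarith
  rw [e] at hbig
  have h1 := abs_add_le (S + (c - L' - na)) θ
  have h2 := abs_add_le S (c - L' - na)
  linarith

/-! ### The S7 count -/
/-- **Band violations are rare (SPEC S7).**  Let `2·jE < #Rᶜ` (the middle fits) and let
`c₀ = 2·jA − #(R ∩ [0,A)) − L − need A` be the head overshoot (`A = vpos (2·jA)`).  If `m₀ > 0` and
`m₀ + 2 + |c₀| ≤ B`, the number of bit strings `y` such that `|h(t) − L − need t| > B` for SOME `t ∈ [A, E′]`
(`h(t) = #openers<t − #closers<t` of `inflateWord R L m y`) is at most `2J·exp(−m₀²/(8J))·4^J`, `J = #Rᶜ/2`.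
[folklore] -/
theorem card_filter_band_violated_le (h2 : 2 * tailPairs R L m < Rᶜ.card) {m₀ B : ℝ} (hm₀ : 0 < m₀)
    (hB : m₀ + 2 + |(((2 * headPairs R L m : ℕ) : ℤ) -
        ((R.filter fun i : Fin N => (i : ℕ) < vpos R (2 * headPairs R L m)).card : ℤ) - (L : ℤ) -
        (need R L m (vpos R (2 * headPairs R L m)) : ℤ) : ℝ)| ≤ B) :
    ((univ.filter fun y : Fin (2 * (Rᶜ.card / 2)) → Bool =>
        ∃ t : ℕ, t ≤ tailStart R L m ∧ vpos R (2 * headPairs R L m) ≤ t ∧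
          B < |((((openerSet (inflateWord R L m y)).filter fun i : Fin N => i.val < t).card : ℤ) : ℝ) -
                 ((((closerSet (inflateWord R L m y)).filter fun i : Fin N => i.val < t).card : ℤ) : ℝ) -
                 (L : ℝ) - (need R L m t : ℝ)|).card : ℝ)
      ≤ 2 * (Rᶜ.card / 2 : ℕ) * Real.exp (-(m₀ ^ 2 / (8 * (Rᶜ.card / 2 : ℕ)))) * 4 ^ (Rᶜ.card / 2) := by
  classical
  have hAE : headPairs R L m ≤ tailPairs R L m := headPairs_le R L m
  set jA := headPairs R L m with hjA
  set jE := tailPairs R L m with hjE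
  set A := vpos R (2 * jA) with hAdef
  have h2A : 2 * jA < Rᶜ.card := by omega
  have hvA : vrank R A = 2 * jA := vrank_vpos R h2A
  have hvE : vrank R (tailStart R L m) = 2 * jE := by unfold tailStart; exact vrank_vpos R h2
  -- the deviation at `A` is the constant `c₀`
  have hdevA : ∀ y' : Fin (2 * (Rᶜ.card / 2)) → Bool,
      (∑ s : Fin N, (if (s : ℕ) < A then (if inflateWord R L m y' s then (1 : ℤ) else -1) else 0)) =
        ((2 * jA : ℕ) : ℤ) - ((R.filter fun i : Fin N => (i : ℕ) < A).card : ℤ) := by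
    intro y'
    rw [prefixSum_eq_card_sub_card]
    have h := height_pairStart R L m y' jA le_rfl hAE
    rw [Ico_self, sum_empty, add_zero] at h
    exact h
  refine le_trans ?_ (card_filter_pairWalk_exits_le_of_mask (J := Rᶜ.card / 2)
    (fun j => isInflate R L m j) (fun j : Fin (Rᶜ.card / 2) => jA ≤ (j : ℕ) ∧ (j : ℕ) < jE) hm₀)
  refine Nat.cast_le.2 (card_le_card fun y' hy' => ?_)
  rw [mem_filter] at hy' ⊢
  obtain ⟨-, t, htE, hAt, hbig⟩ := hy'
  refine ⟨mem_univ _, vrank R t / 2, ?_, ?_⟩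
  · have := vrank_mono R htE; rw [hvE] at this
    have := two_mul_tailPairs_le R L m; omega
  -- rewrite the deviation at `t`
  have hvt : 2 * jA ≤ vrank R t := by rw [← hvA]; exact vrank_mono R hAt
  have hkt : vrank R t / 2 ≤ jE := by have := vrank_mono R htE; rw [hvE] at this; omega
  have hdev := dev_eq_dev_add_sum R L m y' t hAt htE
  rw [sum_delta_eq_sum_Ico R L m y' t hvt, hdevA y',
    sum_Ico_eq_pairs_add _ jA (vrank R t) hvt, prefixSum_eq_card_sub_card] at hdev
  rw [maskedSum_eq R L m y' hkt]
  -- name the walk value and the boundary term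
  obtain ⟨Sv, hSv⟩ : ∃ Sv : ℤ, (∑ j ∈ Ico jA (vrank R t / 2),
      (((if preLetter R L m y' (2 * j) then (1 : ℤ) else -1) -
          (if (2 * j) % 2 = 0 ∧ isInflate R L m ((2 * j) / 2) = true then 1 else 0)) +
        ((if preLetter R L m y' (2 * j + 1) then (1 : ℤ) else -1) -
          (if (2 * j + 1) % 2 = 0 ∧ isInflate R L m ((2 * j + 1) / 2) = true then 1 else 0)))) = Sv :=
    ⟨_, rfl⟩
  have hθ2 : |(if vrank R t % 2 = 1 then
      ((if preLetter R L m y' (2 * (vrank R t / 2)) then (1 : ℤ) else -1) -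
        (if (2 * (vrank R t / 2)) % 2 = 0 ∧ isInflate R L m ((2 * (vrank R t / 2)) / 2) = true then 1 else 0))
      else 0)| ≤ 2 := by
    by_cases hodd : vrank R t % 2 = 1
    · rw [if_pos hodd]; exact abs_delta_le R L m y' _
    · rw [if_neg hodd]; simp
  obtain ⟨θv, hθv⟩ : ∃ θv : ℤ, (if vrank R t % 2 = 1 then
      ((if preLetter R L m y' (2 * (vrank R t / 2)) then (1 : ℤ) else -1) -
        (if (2 * (vrank R t / 2)) % 2 = 0 ∧ isInflate R L m ((2 * (vrank R t / 2)) / 2) = true then 1 else 0))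
      else 0) = θv := ⟨_, rfl⟩
  rw [hθv] at hθ2
  rw [hSv, hθv] at hdev
  rw [hSv]
  have hR := congrArg (fun z : ℤ => (z : ℝ)) hdev
  push_cast at hR hbig hB ⊢
  have hθR : |(θv : ℝ)| ≤ 2 := by exact_mod_cast hθ2
  exact abs_walk_ge hR hθR hB hbig

end Summit.ValiantsHypothesis.ValiantsHypothesis.Theorems.FifoMatching.NNLinearDegreeCofactorHard.InflateBand

end
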